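import Literature.IUT.HodgeTheaters.TemperedCoveringsCor23KerLevelOfTower
import Literature.IUT.HodgeTheaters.TemperedCoveringsCor23iiOfSpecialFibre
import Literature.IUT.HodgeTheaters.TemperedCoveringsOfSpecialFibreFiniteLevels
import Literature.IUT.HodgeTheaters.CommensuratorLemmas
import Literature.AnabelianGeometry.SemiGraphs.ArithEdgeLikeTwoHosts
import Literature.AnabelianGeometry.SemiGraphs.TemperedMaximalCompact
import Literature.AnabelianGeometry.SemiGraphs.TemperedSpecialFibreDataVertexAction
import HarnessLib

/-!
# [IUTchI] Cor. 2.3 at the GENUINE 𝔛-datum, `ℍ` = ONE VERTEX: the law "`ℍ` is `G_k`-stable" (`hHstab`) DERIVED from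
# "`v` is fixed by the action of `Π^tp_X` on the dual graph", and from the record's own `ℍ` when `ℍ = {v}`

Mochizuki, *Inter-universal Teichmüller theory I: construction of Hodge theaters*, kurims manuscript
(May 2020), §2, Corollary 2.3 (i) p. 47 l. 31–35, (iv) p. 47 l. 44–46, (v) p. 48 l. 1–2; proofs p. 48 l. 13
("Assertion (i) follows immediately from Proposition 2.2"), p. 49 l. 33–34 ("assertion (iv) follows immediately
from assertion (i)"), p. 49 l. 38 – p. 50 l. 2 ("it suffices to verify the following analogue of assertion (v) for a
nonabelian finitely generated free discrete group `G` … `F̂ ⋂ G = F`")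
[cite: Mochizuki2012, Cor 2.3 pp.47-50] (D-0012 claim key; series status DISPUTED; nothing of the series is
asserted here), over Mochizuki, *Semi-graphs of anabelioids*, Publ. RIMS **42** (2006), Ex. 3.10 pp. 43–45
[cite: MochizukiSemiAnbd2006, Ex 3.10 pp.43-45].
[IUTchII] (Dec. 2020) §2 Rmk. 2.1.1 (ii) p. 65 (`Γ^•t_X` = ONE VERTEX), Prop. 2.2 (i) p. 66 l. 27–35
[cite: Mochizuki2012, IUTchII Rmk 2.1.1(ii) p.65]; [SemiAnbd] Thm. 3.7 (i)–(iv) pp. 40–41, Ex. 3.10 p. 44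
[cite: MochizukiSemiAnbd2006, Thm 3.7 pp.40-41; Ex 3.10 p.44].

PROOF-ONLY companion (abc-iut cell, R-C discharge re-arm W9 (i), seat abc-iut-w5-d028; sequel of
`TemperedCoveringsCor23OfSpecialFibreVerticial`, same seat).  No definition, no new `Prop` fact, no statement file edited.

For `Π^tp_ℍ := TpH ∈ verticialSubgroups S.chart v` (`ℍ` = the one-vertex sub-semi-graph `{v}`, [IUTchII]'s `Γ^•t_X`),
the layer-5 certificate's §2 law `hHstab : ∀ g : Π^tp_X, ∃ t, autOfConj g (Π^tp_ℍ) = t Π^tp_ℍ t⁻¹` ("the sub-semi-graph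
`ℍ ⊆ 𝔾` is stabilized by the natural action of `G_k` on `𝔾`", [IUTchI] p. 47 l. 25–26, group form; route (α) of
`Summits/ABC/IUTFork/Conditional/Layer5OfSV06.lean`) is DERIVED from the vertex-level statement
`hfix : ∀ g, g · v = v` for abc-iut-L3-t2's DERIVED action `SpecialFibreData.actVertex` of `Π^tp_X` on the vertices
of `𝒢^c` (`TemperedSpecialFibreDataVertexAction`, [IUTchI] p. 47: `autOfConj g` carries verticial subgroups at `v` to
verticial subgroups at `g · v`, `actVertex_apply_eq_iff`; two verticial subgroups at one vertex are conjugate, [SemiAnbd]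
Prop. 3.2, `exists_conj_of_mem_verticialSubgroups`); over L3's origin-data record `P : SpecialFibreTower.PiData` the
Thm. 3.7 (iv) witness is `P.finite.maximalCompactIffVerticialAt_base` (finite dual graph) and `g · v` IS the record's
semi-graph action `(P.actGraph₀ g).vertexMap v` (`P.actGraph₀_vertexMap`), so that when the record's own sub-semi-graph
is `P.H.verts = {v}` the law follows from the record-law `P.H_stable` ("`ℍ` is `Π`-stable") with NO binder left:

* `hHstab_of_mem_verticialSubgroups_of_fixed` — generic (`hK0`, `hiv`, `hfix` ⟹ `hHstab`);
* `hHstab_of_piData_of_vertexMap_fixed` — over `P` from `hfixG : ∀ g, (P.actGraph₀ g).hom.vertexMap v = v`;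
* `vertexMap_eq_of_H_verts_eq_singleton`, `hHstab_of_piData_of_H_verts_eq_singleton` — from `P.H.verts = {v}`;
* `cor23_i_to_v_ofSpecialFibre_closureH_of_piData_singleVertex` — [IUTchI] Cor. 2.3 (i)–(v) AS TYPED at the genuine
  datum, print's `Π̂_ℍ`, `Π^tp_ℍ := TpH` verticial at `v`, `P.H.verts = {v}`: laws `{hhat, hA, hB}` ONLY (route (α) list
  `{h22, hHstab, hA, hB}` + `hv`: `hv` by compactness, `h22`'s tempered clause by [SemiAnbd] Thm. 3.7 (ii)
  (`commensurator_eq_of_mem_verticialSubgroups`), `hHstab` by this file); assembly = abc-iut-w4-d058's p438500 chain BY NAME.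

HONEST RESIDUAL at `ℍ = Γ^•t`: `hhat` ([SemiAnbd] Cor. 2.7 (i) / [CombGC] Prop. 1.2 (ii), profinite side; FACT route),
the per-level KER-LEVEL inputs `hA`/`hB` of (iii) (G-w4d058-1); side conditions on DATA: `TpH ∈ verticialSubgroups S.chart v`,
`P.H.verts = {v}`.  General `ℍ` (e.g. `Γ^▶`): GAP-LEDGER G-w5d028-2.  Model-RELATIVE (∀ `X`, `d`, `S`, `T`, `P`); typed ≠
discharged; a binder is an assumption label; nothing here bears on [IUTchIII] Cor. 3.12 or asserts abc proved or refuted.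
-/

noncomputable section

namespace Literature.IUT.HodgeTheaters

open _root_.Topology
open scoped Pointwise
open Literature.AnabelianGeometry.SemiGraphs
open Literature.AnabelianGeometry.SemiGraphs.ProfiniteSemiGraph (verticialSubgroups MaximalCompactIffVerticialAt
  isCompact_of_mem_verticialSubgroups commensurator_eq_of_mem_verticialSubgroups exists_conj_of_mem_verticialSubgroups)
open Literature.AnabelianGeometry.AbsoluteAnabelian (IsCommensurablyTerminal)
open Literature.AlgebraicGeometry.Frobenioids (IsSlimGroup)
open Literature.IUT.HodgeTheaters.IsCommensurablyTerminal (comap_of_surjective)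

namespace StableCurveTemperedData

/-! ### A. `hHstab` from vertex-fixedness -/

section Stab

variable {p : ℕ} [Fact p.Prime] (X : TemperedCurve p) (d : X.GroupLevelData)
  (S : SpecialFibreData (X.toTemperedArithmeticGroup d)) (TpH : Subgroup S.chart.G)

/-- **`hHstab` at `ℍ = {v}` from "`v` is fixed"**: if `TpH` is verticial at `v` and every `g ∈ Π^tp_X` fixes `v` for the derived
vertex action, then `autOfConj g` carries `TpH` to a `π₁^temp(G^c)`-conjugate of itself ([IUTchI] p. 47 l. 25–26 in group form).
[cite: Mochizuki2012, Cor 2.3(i) p.47] -/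
theorem hHstab_of_mem_verticialSubgroups_of_fixed
    (hK0 : (S.admissible.toMonoidHom.ker.map (X.toTemperedArithmeticGroup d).delta.subtype).Normal)
    (hiv : MaximalCompactIffVerticialAt S.Gc) {v : S.Gc.graph.Vertex} (hH : TpH ∈ verticialSubgroups S.chart v)
    (hfix : ∀ g : X.PiTemp, S.actVertex hK0 hiv g v = v) :
    ∀ g : X.PiTemp, ∃ t : S.chart.G,
      TpH.map (S.autOfConj hK0 g).toMulEquiv.toMonoidHom = MulAut.conj t • TpH := by
  intro g
  have h1 : TpH.map (S.autOfConj hK0 g).toMonoidHom ∈ verticialSubgroups S.chart v :=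
    (S.actVertex_apply_eq_iff hK0 hiv g v v).1 (hfix g) TpH hH
  obtain ⟨t, ht⟩ := exists_conj_of_mem_verticialSubgroups S.chart hH h1
  exact ⟨t, ht⟩

end Stab

/-! ### B. Over L3's `SpecialFibreTower.PiData`: the Thm. 3.7 (iv) witness and `g · v` from the record -/

section Record

variable {p : ℕ} [Fact p.Prime] (X : TemperedCurve p) (d : X.GroupLevelData)
  (S : SpecialFibreData (X.toTemperedArithmeticGroup d)) (TpH : Subgroup S.chart.G)
  (T : SpecialFibreTower X.DeltaTemp) (P : SpecialFibreTower.PiData X d S T)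

/-- **`hHstab` over the record from "`v` is fixed by the semi-graph action `P.actGraph₀`"** (Thm. 3.7 (iv) at the finite
base fibre is `P.finite.maximalCompactIffVerticialAt_base`; the record-law `P.actGraph₀_vertexMap` identifies the vertex
part of `P.actGraph₀ g` with the derived `actVertex`). [cite: Mochizuki2012, Cor 2.3(i) p.47] -/
theorem hHstab_of_piData_of_vertexMap_fixed {v : S.Gc.graph.Vertex} (hH : TpH ∈ verticialSubgroups S.chart v)
    (hfixG : ∀ g : X.PiTemp, (P.actGraph₀ g).hom.vertexMap v = v) :
    ∀ g : X.PiTemp, ∃ t : S.chart.G,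
      TpH.map (S.autOfConj P.admissibleKer_normal_pi g).toMulEquiv.toMonoidHom = MulAut.conj t • TpH :=
  hHstab_of_mem_verticialSubgroups_of_fixed X d S TpH P.admissibleKer_normal_pi
    P.finite.maximalCompactIffVerticialAt_base hH fun g => by
      rw [← P.actGraph₀_vertexMap P.finite.maximalCompactIffVerticialAt_base g v]
      exact hfixG g

/-- **When the record's own sub-semi-graph is the single vertex `v`** (`P.H.verts = {v}`, [IUTchII] `Γ^•t_X`), the
record-law `P.H_stable` ("`ℍ` is `Π`-stable", [IUTchI] p. 47) says `g · v = v`. [cite: Mochizuki2012, Cor 2.3(i) p.47] -/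
theorem vertexMap_eq_of_H_verts_eq_singleton {v : S.Gc.graph.Vertex} (hHv : P.H.verts = {v}) :
    ∀ g : X.PiTemp, (P.actGraph₀ g).hom.vertexMap v = v := by
  intro g
  have hv : v ∈ P.H.verts := by rw [hHv]; exact Set.mem_singleton v
  have h := (P.H_stable g).1 v hv
  rw [hHv] at h
  exact h

/-- **`hHstab` with NO binder left at `ℍ = {v}`**: `P.H.verts = {v}` and `TpH` verticial at `v`.
[cite: Mochizuki2012, Cor 2.3(i) p.47] -/
theorem hHstab_of_piData_of_H_verts_eq_singleton {v : S.Gc.graph.Vertex} (hHv : P.H.verts = {v})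
    (hH : TpH ∈ verticialSubgroups S.chart v) :
    ∀ g : X.PiTemp, ∃ t : S.chart.G,
      TpH.map (S.autOfConj P.admissibleKer_normal_pi g).toMulEquiv.toMonoidHom = MulAut.conj t • TpH :=
  hHstab_of_piData_of_vertexMap_fixed X d S TpH T P hH (vertexMap_eq_of_H_verts_eq_singleton X d S T P hHv)

end Record

/-! ### C. [IUTchI] Cor. 2.3 (i)–(v) at the genuine datum, `ℍ` = the record's single vertex: laws `{hhat, hA, hB}` -/

section Block

variable {p : ℕ} [Fact p.Prime] (X : TemperedCurve p) (d : X.GroupLevelData)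
  (S : SpecialFibreData (X.toTemperedArithmeticGroup d)) (h36 : S.Gc.Prop36Hypotheses)
  (Sigma SigmaHat : Set ℕ) (hsub : Sigma ⊆ SigmaHat) (hne : Sigma.Nonempty)
  (hprime : ∀ q ∈ SigmaHat, q.Prime) (hp : p ∉ Sigma)
  (TpH : Subgroup S.chart.G)
  (cuspMeetsH : {x : X.Pt // X.IsCusp x} → Prop)
  (T : SpecialFibreTower X.DeltaTemp)

/-- **[IUTchI] Cor. 2.3 (i)–(v) AS TYPED at the genuine datum, print's `Π̂_ℍ`, over L3's `PiData` record whose sub-semi-graph is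
ONE VERTEX `v` (`P.H.verts = {v}`), `Π^tp_ℍ := TpH` verticial at `v`**: from the laws `{hhat, hA, hB}` ONLY — `hhat` =
`C_{Π̂_𝔾}(Π̂_ℍ) = Π̂_ℍ` ([SemiAnbd] Cor. 2.7 (i)), `hA`/`hB` = the per-level KER-LEVEL of (iii).  Of the certificate route (α) laws
`{h22, hHstab, hA, hB, hv}`: `h22`'s tempered clause is [SemiAnbd] Thm. 3.7 (ii) (`commensurator_eq_of_mem_verticialSubgroups`),
its other clauses are not consumed; `hHstab` is `hHstab_of_piData_of_H_verts_eq_singleton`; `hv` holds by compactness of `Π_v`.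
Assembly = abc-iut-w4-d058's p438500 chain BY NAME. [cite: Mochizuki2012, Cor 2.3 pp.47-50] -/
theorem cor23_i_to_v_ofSpecialFibre_closureH_of_piData_singleVertex (P : SpecialFibreTower.PiData X d S T)
    (hA : (∃ l ∈ SigmaHat, l ∉ Sigma ∧ l ≠ p) →
      ∀ (i : ℕ) (a : (ofSpecialFibre X d S h36 Sigma SigmaHat hsub hne hprime hp TpH
      ((TpH.map (TemperedGraphGroupData.exists_completion_of_prop36 S.Gc h36
        S.chart).choose_spec.choose.toMonoidHom).topologicalClosure) (Subgroup.le_topologicalClosure _) cuspMeetsH).DeltaHat),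
        (∀ x ∈ ((OfSpecialFibre.towerOfSpecialFibreTower X d T Sigma SigmaHat hsub hne hprime S h36 hp TpH
        ((TpH.map (TemperedGraphGroupData.exists_completion_of_prop36 S.Gc h36
        S.chart).choose_spec.choose.toMonoidHom).topologicalClosure) (Subgroup.le_topologicalClosure _)
        cuspMeetsH).Jhat i).subgroupOf (ofSpecialFibre X d S h36 Sigma SigmaHat hsub hne hprime hp TpH
      ((TpH.map (TemperedGraphGroupData.exists_completion_of_prop36 S.Gc h36
        S.chart).choose_spec.choose.toMonoidHom).topologicalClosure) (Subgroup.le_topologicalClosure _) cuspMeetsH).DeltaHat,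
          x ∈ (ofSpecialFibre X d S h36 Sigma SigmaHat hsub hne hprime hp TpH
      ((TpH.map (TemperedGraphGroupData.exists_completion_of_prop36 S.Gc h36
        S.chart).choose_spec.choose.toMonoidHom).topologicalClosure) (Subgroup.le_topologicalClosure _) cuspMeetsH).ρHat.ker → a * x = x * a) →
        a ∈ ((OfSpecialFibre.towerOfSpecialFibreTower X d T Sigma SigmaHat hsub hne hprime S h36 hp TpH
        ((TpH.map (TemperedGraphGroupData.exists_completion_of_prop36 S.Gc h36
        S.chart).choose_spec.choose.toMonoidHom).topologicalClosure) (Subgroup.le_topologicalClosure _)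
        cuspMeetsH).Jhat i).subgroupOf (ofSpecialFibre X d S h36 Sigma SigmaHat hsub hne hprime hp TpH
      ((TpH.map (TemperedGraphGroupData.exists_completion_of_prop36 S.Gc h36
        S.chart).choose_spec.choose.toMonoidHom).topologicalClosure) (Subgroup.le_topologicalClosure _) cuspMeetsH).DeltaHat)
    (hB : SigmaHat = {q | q.Prime} →
      ∀ (i : ℕ) (a : (ofSpecialFibre X d S h36 Sigma SigmaHat hsub hne hprime hp TpH
      ((TpH.map (TemperedGraphGroupData.exists_completion_of_prop36 S.Gc h36
        S.chart).choose_spec.choose.toMonoidHom).topologicalClosure) (Subgroup.le_topologicalClosure _) cuspMeetsH).DeltaHat),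
        (∀ x ∈ ((OfSpecialFibre.towerOfSpecialFibreTower X d T Sigma SigmaHat hsub hne hprime S h36 hp TpH
        ((TpH.map (TemperedGraphGroupData.exists_completion_of_prop36 S.Gc h36
        S.chart).choose_spec.choose.toMonoidHom).topologicalClosure) (Subgroup.le_topologicalClosure _)
        cuspMeetsH).Jhat i).subgroupOf (ofSpecialFibre X d S h36 Sigma SigmaHat hsub hne hprime hp TpH
      ((TpH.map (TemperedGraphGroupData.exists_completion_of_prop36 S.Gc h36
        S.chart).choose_spec.choose.toMonoidHom).topologicalClosure) (Subgroup.le_topologicalClosure _) cuspMeetsH).DeltaHat,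
          x ∈ (ofSpecialFibre X d S h36 Sigma SigmaHat hsub hne hprime hp TpH
      ((TpH.map (TemperedGraphGroupData.exists_completion_of_prop36 S.Gc h36
        S.chart).choose_spec.choose.toMonoidHom).topologicalClosure) (Subgroup.le_topologicalClosure _) cuspMeetsH).ρHat.ker → a * x = x * a) →
        a ∈ ((OfSpecialFibre.towerOfSpecialFibreTower X d T Sigma SigmaHat hsub hne hprime S h36 hp TpH
        ((TpH.map (TemperedGraphGroupData.exists_completion_of_prop36 S.Gc h36
        S.chart).choose_spec.choose.toMonoidHom).topologicalClosure) (Subgroup.le_topologicalClosure _)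
        cuspMeetsH).Jhat i).subgroupOf (ofSpecialFibre X d S h36 Sigma SigmaHat hsub hne hprime hp TpH
      ((TpH.map (TemperedGraphGroupData.exists_completion_of_prop36 S.Gc h36
        S.chart).choose_spec.choose.toMonoidHom).topologicalClosure) (Subgroup.le_topologicalClosure _) cuspMeetsH).DeltaHat)
    {v : S.Gc.graph.Vertex} (hHv : P.H.verts = {v}) (hH : TpH ∈ verticialSubgroups S.chart v)
    (hhat : IsCommensurablyTerminal ((TpH.map (TemperedGraphGroupData.exists_completion_of_prop36 S.Gc h36 S.chart).choose_spec.choose.toMonoidHom).topologicalClosure)) :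
    ((ofSpecialFibre X d S h36 Sigma SigmaHat hsub hne hprime hp TpH
      ((TpH.map (TemperedGraphGroupData.exists_completion_of_prop36 S.Gc h36
        S.chart).choose_spec.choose.toMonoidHom).topologicalClosure) (Subgroup.le_topologicalClosure _) cuspMeetsH).Cor23i ∧
      (ofSpecialFibre X d S h36 Sigma SigmaHat hsub hne hprime hp TpH
      ((TpH.map (TemperedGraphGroupData.exists_completion_of_prop36 S.Gc h36
        S.chart).choose_spec.choose.toMonoidHom).topologicalClosure) (Subgroup.le_topologicalClosure _) cuspMeetsH).Cor23ii ∧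
      (ofSpecialFibre X d S h36 Sigma SigmaHat hsub hne hprime hp TpH
      ((TpH.map (TemperedGraphGroupData.exists_completion_of_prop36 S.Gc h36
        S.chart).choose_spec.choose.toMonoidHom).topologicalClosure) (Subgroup.le_topologicalClosure _) cuspMeetsH).Cor23iii ∧
      (ofSpecialFibre X d S h36 Sigma SigmaHat hsub hne hprime hp TpH
      ((TpH.map (TemperedGraphGroupData.exists_completion_of_prop36 S.Gc h36
        S.chart).choose_spec.choose.toMonoidHom).topologicalClosure) (Subgroup.le_topologicalClosure _) cuspMeetsH).Cor23iv) ∧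
      (ofSpecialFibre X d S h36 Sigma SigmaHat hsub hne hprime hp TpH
      ((TpH.map (TemperedGraphGroupData.exists_completion_of_prop36 S.Gc h36
        S.chart).choose_spec.choose.toMonoidHom).topologicalClosure) (Subgroup.le_topologicalClosure _) cuspMeetsH).Cor23v := by
  haveI := ofSpecialFibre_t2Space_piHat X d S h36 Sigma SigmaHat hsub hne hprime hp TpH
      ((TpH.map (TemperedGraphGroupData.exists_completion_of_prop36 S.Gc h36
        S.chart).choose_spec.choose.toMonoidHom).topologicalClosure) (Subgroup.le_topologicalClosure _)
      cuspMeetsH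
  haveI := ofSpecialFibre_totallyDisconnectedSpace_piHat X d S h36 Sigma SigmaHat hsub hne hprime hp TpH
      ((TpH.map (TemperedGraphGroupData.exists_completion_of_prop36 S.Gc h36
        S.chart).choose_spec.choose.toMonoidHom).topologicalClosure) (Subgroup.le_topologicalClosure _)
      cuspMeetsH
  haveI : T2Space (TemperedGraphGroupData.exists_completion_of_prop36 S.Gc h36 S.chart).choose := (OfSpecialFibre.iotaG_isProfiniteCompletion X d S h36).t2Space
  -- print's Π̂_ℍ = closure ι(Π_v) = ι(Π_v): compact image in a Hausdorff group
  have hmap : ((TpH.map (TemperedGraphGroupData.exists_completion_of_prop36 S.Gc h36 S.chart).choose_spec.choose.toMonoidHom).topologicalClosure) =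
      TpH.map (TemperedGraphGroupData.exists_completion_of_prop36 S.Gc h36 S.chart).choose_spec.choose.toMonoidHom := by
    refine le_antisymm (Subgroup.topologicalClosure_minimal _ le_rfl ?_) (Subgroup.le_topologicalClosure _)
    rw [Subgroup.coe_map]
    exact ((isCompact_of_mem_verticialSubgroups S.chart hH).image (TemperedGraphGroupData.exists_completion_of_prop36 S.Gc h36 S.chart).choose_spec.choose.continuous).isClosed
  -- (i): tempered clause = Thm 3.7 (ii); profinite clause = hhat
  have hi : (ofSpecialFibre X d S h36 Sigma SigmaHat hsub hne hprime hp TpH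
      ((TpH.map (TemperedGraphGroupData.exists_completion_of_prop36 S.Gc h36
        S.chart).choose_spec.choose.toMonoidHom).topologicalClosure) (Subgroup.le_topologicalClosure _) cuspMeetsH).Cor23i :=
    ⟨⟨comap_of_surjective (ofSpecialFibre X d S h36 Sigma SigmaHat hsub hne hprime hp TpH
      ((TpH.map (TemperedGraphGroupData.exists_completion_of_prop36 S.Gc h36
        S.chart).choose_spec.choose.toMonoidHom).topologicalClosure) (Subgroup.le_topologicalClosure _) cuspMeetsH).ρTp
        (ofSpecialFibre X d S h36 Sigma SigmaHat hsub hne hprime hp TpH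
      ((TpH.map (TemperedGraphGroupData.exists_completion_of_prop36 S.Gc h36
        S.chart).choose_spec.choose.toMonoidHom).topologicalClosure) (Subgroup.le_topologicalClosure _) cuspMeetsH).ρTp_surjective
        (commensurator_eq_of_mem_verticialSubgroups S.hyp S.chart hH)⟩,
      ⟨comap_of_surjective (ofSpecialFibre X d S h36 Sigma SigmaHat hsub hne hprime hp TpH
      ((TpH.map (TemperedGraphGroupData.exists_completion_of_prop36 S.Gc h36
        S.chart).choose_spec.choose.toMonoidHom).topologicalClosure) (Subgroup.le_topologicalClosure _) cuspMeetsH).ρHat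
        (ofSpecialFibre X d S h36 Sigma SigmaHat hsub hne hprime hp TpH
      ((TpH.map (TemperedGraphGroupData.exists_completion_of_prop36 S.Gc h36
        S.chart).choose_spec.choose.toMonoidHom).topologicalClosure) (Subgroup.le_topologicalClosure _) cuspMeetsH).ρHat_surjective hhat.commensurator_eq⟩⟩
  -- (ii): hH definitional at print's parameter
  have hii : (ofSpecialFibre X d S h36 Sigma SigmaHat hsub hne hprime hp TpH
      ((TpH.map (TemperedGraphGroupData.exists_completion_of_prop36 S.Gc h36
        S.chart).choose_spec.choose.toMonoidHom).topologicalClosure) (Subgroup.le_topologicalClosure _) cuspMeetsH).Cor23ii :=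
    cor23ii_ofSpecialFibre X d S h36 Sigma SigmaHat hsub hne hprime hp TpH
      ((TpH.map (TemperedGraphGroupData.exists_completion_of_prop36 S.Gc h36
        S.chart).choose_spec.choose.toMonoidHom).topologicalClosure) (Subgroup.le_topologicalClosure _)
      cuspMeetsH (by
      show ((((TpH.map (TemperedGraphGroupData.exists_completion_of_prop36 S.Gc h36 S.chart).choose_spec.choose.toMonoidHom).topologicalClosure) :
          Subgroup (TemperedGraphGroupData.exists_completion_of_prop36 S.Gc h36 S.chart).choose) : Set (TemperedGraphGroupData.exists_completion_of_prop36 S.Gc h36 S.chart).choose) =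
        closure ((TemperedGraphGroupData.exists_completion_of_prop36 S.Gc h36 S.chart).choose_spec.choose.toMonoidHom '' (TpH : Set S.chart.G))
      rw [Subgroup.topologicalClosure_coe, Subgroup.coe_map])
  -- hHstab DERIVED, then the outer descent atoms
  have hHstab := hHstab_of_piData_of_H_verts_eq_singleton X d S TpH T P hHv hH
  have hOutTp := ofSpecialFibre_outerTp_of_graphStable X d S h36 Sigma SigmaHat hsub hne hprime hp TpH
      ((TpH.map (TemperedGraphGroupData.exists_completion_of_prop36 S.Gc h36
        S.chart).choose_spec.choose.toMonoidHom).topologicalClosure) (Subgroup.le_topologicalClosure _)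
      cuspMeetsH
    P.admissibleKer_normal_pi hHstab
  have hOutHat := (ofSpecialFibre X d S h36 Sigma SigmaHat hsub hne hprime hp TpH
      ((TpH.map (TemperedGraphGroupData.exists_completion_of_prop36 S.Gc h36
        S.chart).choose_spec.choose.toMonoidHom).topologicalClosure) (Subgroup.le_topologicalClosure _) cuspMeetsH).outerHat_of_outerTp hii hOutTp
  -- slimness from KER-LEVEL at the tower levels
  have hA' := fun ha => kerLevel_all_ofSpecialFibre_of_towerLevels X d S h36 Sigma SigmaHat hsub hne hprime hp TpH
      ((TpH.map (TemperedGraphGroupData.exists_completion_of_prop36 S.Gc h36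
        S.chart).choose_spec.choose.toMonoidHom).topologicalClosure) (Subgroup.le_topologicalClosure _)
      cuspMeetsH T
    P.N_cofinal (hA ha)
  have hB' := fun hb => kerLevel_all_ofSpecialFibre_of_towerLevels X d S h36 Sigma SigmaHat hsub hne hprime hp TpH
      ((TpH.map (TemperedGraphGroupData.exists_completion_of_prop36 S.Gc h36
        S.chart).choose_spec.choose.toMonoidHom).topologicalClosure) (Subgroup.le_topologicalClosure _)
      cuspMeetsH T
    P.N_cofinal (hB hb)
  have hslim : (ofSpecialFibre X d S h36 Sigma SigmaHat hsub hne hprime hp TpH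
      ((TpH.map (TemperedGraphGroupData.exists_completion_of_prop36 S.Gc h36
        S.chart).choose_spec.choose.toMonoidHom).topologicalClosure) (Subgroup.le_topologicalClosure _) cuspMeetsH).Cor23Hyp →
      IsSlimGroup (ofSpecialFibre X d S h36 Sigma SigmaHat hsub hne hprime hp TpH
      ((TpH.map (TemperedGraphGroupData.exists_completion_of_prop36 S.Gc h36
        S.chart).choose_spec.choose.toMonoidHom).topologicalClosure) (Subgroup.le_topologicalClosure _) cuspMeetsH).deltaHatH :=
    (ofSpecialFibre X d S h36 Sigma SigmaHat hsub hne hprime hp TpH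
      ((TpH.map (TemperedGraphGroupData.exists_completion_of_prop36 S.Gc h36
        S.chart).choose_spec.choose.toMonoidHom).topologicalClosure) (Subgroup.le_topologicalClosure _) cuspMeetsH).slim_of_cor23Hyp_of_levels
      (ofSpecialFibre_isClosed_deltaHat X d S h36 Sigma SigmaHat hsub hne hprime hp TpH
      ((TpH.map (TemperedGraphGroupData.exists_completion_of_prop36 S.Gc h36
        S.chart).choose_spec.choose.toMonoidHom).topologicalClosure) (Subgroup.le_topologicalClosure _)
      cuspMeetsH)
      (fun W : {W : Subgroup (ofSpecialFibre X d S h36 Sigma SigmaHat hsub hne hprime hp TpH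
      ((TpH.map (TemperedGraphGroupData.exists_completion_of_prop36 S.Gc h36
        S.chart).choose_spec.choose.toMonoidHom).topologicalClosure) (Subgroup.le_topologicalClosure _) cuspMeetsH).DeltaHat //
          W.Normal ∧ IsOpen (W : Set (ofSpecialFibre X d S h36 Sigma SigmaHat hsub hne hprime hp TpH
      ((TpH.map (TemperedGraphGroupData.exists_completion_of_prop36 S.Gc h36
        S.chart).choose_spec.choose.toMonoidHom).topologicalClosure) (Subgroup.le_topologicalClosure _) cuspMeetsH).DeltaHat)} => W.1)
      (fun W hn ho => ⟨⟨W, hn, ho⟩, le_rfl⟩)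
      (fun ha i a h => hA' ha i.1 i.2.1 i.2.2 a fun x hxJ hxK =>
        h x hxJ ((ofSpecialFibre X d S h36 Sigma SigmaHat hsub hne hprime hp TpH
      ((TpH.map (TemperedGraphGroupData.exists_completion_of_prop36 S.Gc h36
        S.chart).choose_spec.choose.toMonoidHom).topologicalClosure) (Subgroup.le_topologicalClosure _) cuspMeetsH).ker_ρHat_le_deltaHatH hxK))
      (fun hb i a h => hB' hb i.1 i.2.1 i.2.2 a fun x hxJ hxK =>
        h x hxJ ((ofSpecialFibre X d S h36 Sigma SigmaHat hsub hne hprime hp TpH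
      ((TpH.map (TemperedGraphGroupData.exists_completion_of_prop36 S.Gc h36
        S.chart).choose_spec.choose.toMonoidHom).topologicalClosure) (Subgroup.le_topologicalClosure _) cuspMeetsH).ker_ρHat_le_deltaHatH hxK))
  -- (v): Π̂_ℍ ∩ Π^tp_𝔾 = ι(Π^tp_ℍ) since Π̂_ℍ = ι(Π^tp_ℍ)
  have hv : (ofSpecialFibre X d S h36 Sigma SigmaHat hsub hne hprime hp TpH
      ((TpH.map (TemperedGraphGroupData.exists_completion_of_prop36 S.Gc h36
        S.chart).choose_spec.choose.toMonoidHom).topologicalClosure) (Subgroup.le_topologicalClosure _) cuspMeetsH).Cor23v := by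
    refine (ofSpecialFibre X d S h36 Sigma SigmaHat hsub hne hprime hp TpH
      ((TpH.map (TemperedGraphGroupData.exists_completion_of_prop36 S.Gc h36
        S.chart).choose_spec.choose.toMonoidHom).topologicalClosure) (Subgroup.le_topologicalClosure _) cuspMeetsH).cor23v_of_graph (Set.Subset.antisymm ?_ ?_)
    · rintro _ ⟨hyH, ⟨t, rfl⟩⟩
      have h' : (TemperedGraphGroupData.exists_completion_of_prop36 S.Gc h36 S.chart).choose_spec.choose.toMonoidHom t ∈
          ((TpH.map (TemperedGraphGroupData.exists_completion_of_prop36 S.Gc h36 S.chart).choose_spec.choose.toMonoidHom).topologicalClosure) := hyH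
      rw [hmap] at h'
      obtain ⟨s, hs, hst⟩ := h'
      have hst' : s = t :=
        (TemperedGraphGroupData.exists_completion_of_prop36 S.Gc h36 S.chart).choose_spec.choose_spec.2 hst
      subst hst'
      exact ⟨s, hs, rfl⟩
    · rintro _ ⟨t, ht, rfl⟩
      exact ⟨(ofSpecialFibre X d S h36 Sigma SigmaHat hsub hne hprime hp TpH
      ((TpH.map (TemperedGraphGroupData.exists_completion_of_prop36 S.Gc h36
        S.chart).choose_spec.choose.toMonoidHom).topologicalClosure) (Subgroup.le_topologicalClosure _) cuspMeetsH).graph.tpH_le ⟨t, ht, rfl⟩, ⟨t, rfl⟩⟩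
  exact ⟨⟨hi, hii,
    cor23iii_ofSpecialFibre_of_slim X d S h36 Sigma SigmaHat hsub hne hprime hp TpH
      ((TpH.map (TemperedGraphGroupData.exists_completion_of_prop36 S.Gc h36
        S.chart).choose_spec.choose.toMonoidHom).topologicalClosure) (Subgroup.le_topologicalClosure _)
      cuspMeetsH hi hii hslim hOutTp hOutHat,
    cor23iv_ofSpecialFibre_of_slim X d S h36 Sigma SigmaHat hsub hne hprime hp TpH
      ((TpH.map (TemperedGraphGroupData.exists_completion_of_prop36 S.Gc h36
        S.chart).choose_spec.choose.toMonoidHom).topologicalClosure) (Subgroup.le_topologicalClosure _)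
      cuspMeetsH hi hii hslim hOutTp hOutHat⟩, hv⟩

/-- **The same for FINITE `Σ`** (the IUT case `Σ = {l}`): laws `{hhat, hA}`. [cite: Mochizuki2012, Cor 2.3 pp.47-50] -/
theorem cor23_i_to_v_ofSpecialFibre_closureH_of_piData_singleVertex_of_finite (P : SpecialFibreTower.PiData X d S T)
    (hfin : Sigma.Finite)
    (hA : (∃ l ∈ SigmaHat, l ∉ Sigma ∧ l ≠ p) →
      ∀ (i : ℕ) (a : (ofSpecialFibre X d S h36 Sigma SigmaHat hsub hne hprime hp TpH
      ((TpH.map (TemperedGraphGroupData.exists_completion_of_prop36 S.Gc h36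
        S.chart).choose_spec.choose.toMonoidHom).topologicalClosure) (Subgroup.le_topologicalClosure _) cuspMeetsH).DeltaHat),
        (∀ x ∈ ((OfSpecialFibre.towerOfSpecialFibreTower X d T Sigma SigmaHat hsub hne hprime S h36 hp TpH
        ((TpH.map (TemperedGraphGroupData.exists_completion_of_prop36 S.Gc h36
        S.chart).choose_spec.choose.toMonoidHom).topologicalClosure) (Subgroup.le_topologicalClosure _)
        cuspMeetsH).Jhat i).subgroupOf (ofSpecialFibre X d S h36 Sigma SigmaHat hsub hne hprime hp TpH
      ((TpH.map (TemperedGraphGroupData.exists_completion_of_prop36 S.Gc h36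
        S.chart).choose_spec.choose.toMonoidHom).topologicalClosure) (Subgroup.le_topologicalClosure _) cuspMeetsH).DeltaHat,
          x ∈ (ofSpecialFibre X d S h36 Sigma SigmaHat hsub hne hprime hp TpH
      ((TpH.map (TemperedGraphGroupData.exists_completion_of_prop36 S.Gc h36
        S.chart).choose_spec.choose.toMonoidHom).topologicalClosure) (Subgroup.le_topologicalClosure _) cuspMeetsH).ρHat.ker → a * x = x * a) →
        a ∈ ((OfSpecialFibre.towerOfSpecialFibreTower X d T Sigma SigmaHat hsub hne hprime S h36 hp TpH
        ((TpH.map (TemperedGraphGroupData.exists_completion_of_prop36 S.Gc h36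
        S.chart).choose_spec.choose.toMonoidHom).topologicalClosure) (Subgroup.le_topologicalClosure _)
        cuspMeetsH).Jhat i).subgroupOf (ofSpecialFibre X d S h36 Sigma SigmaHat hsub hne hprime hp TpH
      ((TpH.map (TemperedGraphGroupData.exists_completion_of_prop36 S.Gc h36
        S.chart).choose_spec.choose.toMonoidHom).topologicalClosure) (Subgroup.le_topologicalClosure _) cuspMeetsH).DeltaHat)
    {v : S.Gc.graph.Vertex} (hHv : P.H.verts = {v}) (hH : TpH ∈ verticialSubgroups S.chart v)
    (hhat : IsCommensurablyTerminal ((TpH.map (TemperedGraphGroupData.exists_completion_of_prop36 S.Gc h36 S.chart).choose_spec.choose.toMonoidHom).topologicalClosure)) :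
    ((ofSpecialFibre X d S h36 Sigma SigmaHat hsub hne hprime hp TpH
      ((TpH.map (TemperedGraphGroupData.exists_completion_of_prop36 S.Gc h36
        S.chart).choose_spec.choose.toMonoidHom).topologicalClosure) (Subgroup.le_topologicalClosure _) cuspMeetsH).Cor23i ∧
      (ofSpecialFibre X d S h36 Sigma SigmaHat hsub hne hprime hp TpH
      ((TpH.map (TemperedGraphGroupData.exists_completion_of_prop36 S.Gc h36
        S.chart).choose_spec.choose.toMonoidHom).topologicalClosure) (Subgroup.le_topologicalClosure _) cuspMeetsH).Cor23ii ∧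
      (ofSpecialFibre X d S h36 Sigma SigmaHat hsub hne hprime hp TpH
      ((TpH.map (TemperedGraphGroupData.exists_completion_of_prop36 S.Gc h36
        S.chart).choose_spec.choose.toMonoidHom).topologicalClosure) (Subgroup.le_topologicalClosure _) cuspMeetsH).Cor23iii ∧
      (ofSpecialFibre X d S h36 Sigma SigmaHat hsub hne hprime hp TpH
      ((TpH.map (TemperedGraphGroupData.exists_completion_of_prop36 S.Gc h36
        S.chart).choose_spec.choose.toMonoidHom).topologicalClosure) (Subgroup.le_topologicalClosure _) cuspMeetsH).Cor23iv) ∧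
      (ofSpecialFibre X d S h36 Sigma SigmaHat hsub hne hprime hp TpH
      ((TpH.map (TemperedGraphGroupData.exists_completion_of_prop36 S.Gc h36
        S.chart).choose_spec.choose.toMonoidHom).topologicalClosure) (Subgroup.le_topologicalClosure _) cuspMeetsH).Cor23v :=
  cor23_i_to_v_ofSpecialFibre_closureH_of_piData_singleVertex X d S h36 Sigma SigmaHat hsub hne hprime hp TpH cuspMeetsH T P hA
    (fun hb => hA (cor23iii_condA_of_condB (exists_prime_not_mem_of_finite hfin p) hb)) hHv hH hhat

end Block

end StableCurveTemperedData

end Literature.IUT.HodgeTheaters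

end
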